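import Literature.MathematicalPhysics.QuantumFieldTheory.Balaban1983to89.Node00.OpsYLocalInverse
import Literature.MathematicalPhysics.QuantumFieldTheory.Balaban1983to89.B9Thm37TransposedCommutator

/-!
# NODE 00 — the LEIBNIZ ∕ `K(h)` LETTERS of [B9] (3.88), (3.100) as OPERATOR identities at def-Y's letters (walk-letter instance, FILE B)

[B9] p. 409 L17–19, (3.88): *"`(Δ′_a hλ)(x) = h(x)(Δ′_aλ)(x) − Σ_{b∈st(x)}(∂h)(b)(Dλ)(b) + (Δh)(x)λ(x) = h(x)(Δ′_aλ)(x) − (K(h)λ)(x)`"*;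
p. 409 L21–24, (3.89): *"`|(K(h_□)G′_□h_□λ)(x)| ≤ O(M⁻¹)e^{−δd(y,y′)}|λ|` … It is exactly the bound (2.44) of [4]"* — [4] = Balaban1984PropagatorsII,
whose (2.39)–(2.40) pp. 229–230 display `K(h)` as the FIRST-ORDER part `Σ_b(∂h)(b)(∂λ)(b)` (a bond difference of `h` composed with a covariant
derivative of `λ`) plus the ZEROTH-ORDER part `(Δh)λ` (+ the averaging line) — the split n06-l's `B9Thm37Whole` names `K(h_□) = P_□∇_U + C_□`;
p. 413, (3.100): *"`(D_μhA)(x) = h(x)(D_μA)(x) + (∂_μh)(x)R(U(x,x+ηe_μ))A(x+ηe_μ)`"*; p. 392, (3.8) (the adjoint derivative along the reversed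
bond); pp. 408 L36 – 409 L5 (the cube operators `G′_□(U)` «constructed for this sequence `{Ω_n(□)}`»), p. 409 L12, (3.87).

WHY THIS FILE (cell context: pub-ymgap NODE 00 def-Y, programme W-a = the walk-letter INSTANCE of the rows-18–19 certificate binders; FILE B of
`W-a-DESIGN.md`).  n06-l's M5.7 `B9Thm37CubeCoverCommutators` gives (3.88) and its two display lines POINTWISE (`KhY_apply`,
`cutCommY_lapSL_apply(_print)`, `cdS_cutMulY_apply`), M5.5 `B9Thm37TransposedCommutator` the pointwise regrouping for a LEFT factor
(`commTerm_eq`, `KhY_apply_transposed`) and `B9Thm37CutoffDivTerms.cutMulY_cdsS_eq` ∕ `OpsYRead342Cross.cdS_eq_neg_cdsS_transport` the backward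
Leibniz rule and `∇ = −∇*∘S` pointwise.  The rows-18–19 `Ops` record (`B9Thm37Whole.Identities`: `leibD`, `leibL`, `leibT`, `eq388`, `eq388T`) and
n06-d's coordinate models (`B9WalkLettersCoordsS`) want these as identities between OPERATORS in `End_ℂ(SiteY i → 𝔸)` with NAMED letters, one
per lattice direction `μ` (the `P`-letters must carry every direction — see the cell's OBS-2).  This module supplies, at def-Y's genuine letters
(`cdSL`, `cdsSL`, `lapSL`, `deltaPrimeAY`, `KhY`, `GsqY`; any transporter letter `par`; lattice units):
* §1 the bond differences `∂⁺_μh`, `∂⁻̃_μh` and the lattice Laplacian `Δh` of a real cut-off (`fdiffY`, `bdiffY`, `lapDiffY`) and `M_{Δh} = Σ_μ(M_{∂⁺h} + M_{∂⁻̃h})`;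
* §2 the covariant SHIFTS `S_μ = ∇_{U,μ} + 1`, `S*_μ = ∇*_{U,μ} + 1` (`fshiftSL`, `bshiftSL`), mutually inverse, and the transport dictionary
  `∇*_μ = −S*_μ∇_μ = −∇_μS*_μ`, `∇_μ = −S_μ∇*_μ = −∇*_μS_μ` as operator identities;
* §3 the Leibniz rules (3.100) as operator identities: `∇_μM_h = M_h∇_μ + M_{∂⁺_μh}S_μ` (and in the `leibD` shape `… + (M_{∂⁺h}∇_μ + M_{∂⁺h})`),
  `M_h∇*_μ = ∇*_μM_h − M_{∂⁻̃_μh}S*_μ` (the `leibT` letter `cltY`);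
* §4 the GRADIENT-RIGHT split (print's `K(h) = P∇_U + C`): `K_Δ(h) = Σ_μ P_μ∇_{U,μ} + M_{Δh}`, `P_μ = M_{∂⁺_μh} − M_{∂⁻̃_μh}S*_μ` (`pKY`), hence
  ★★ `KhY = Σ_μ pKY_μ ∘ ∇_{U,μ} + cKY` (`cKY = M_{Δh} + the averaging line`) and the `leibL` shape `Δ_UM_h = M_hΔ_U + (Σ_μ(−P_μ)∇_μ − M_{Δh})`;
* §5 the DIVERGENCE-LEFT split (for the transposed (3.88), an operator acting on the left of `K(h)`): ★★ `KhY = −(Σ_μ ∇*_{U,μ} ∘ ptKY_μ + ctKY)`,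
  `ptKY_μ = M_{∂⁺_μh}(S_μ + 1)`, `ctKY = M_{Δh} − the averaging line`;
* §6 the RIGHT local-inverse property `h G′_□(U) Δ′_a(U) h = h²` DISCHARGED at def-Y's genuine cube inverses `GsqY` (twin of FILE A-0's
  `cutMulY_deltaPrimeAY_GsqY_cutMulY`), hence the transposed (3.88) `(Σ_□h_□G′_□h_□)Δ′_a = 1 + Σ_□h_□G′_□K(h_□)` at `GsqY` (M5.5's `eq388T_sum` with
  its hypothesis discharged) and (3.90)ᵀ as a fixed point for any right inverse of `Δ′_a(U)`.
Nothing of (3.89) (the SIZES of the letters), of Theorem 3.7, or of the coordinate reading is asserted here: those are n06's (`B9Thm37CommutatorBound389`,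
`B9WalkLettersCoordsS`).  No continuum limit, no OS axioms, no mass gap.

WHAT IS PROVED (all `theorem`s, no `sorry`): §1 `lapDiffY_eq_sum`, `fdiffY_symm_apply`, `bdiffY_shift_apply`, `cutMulY_lapDiffY`; §2 `fshiftSL_apply`,
`bshiftSL_apply`, `fshiftSL_mul_bshiftSL`, `bshiftSL_mul_fshiftSL`, `cdsSL_eq_neg_bshiftSL_mul_cdSL`, `cdsSL_eq_neg_cdSL_mul_bshiftSL`,
`cdSL_eq_neg_fshiftSL_mul_cdsSL`, `cdSL_eq_neg_cdsSL_mul_fshiftSL`; §3 `cdSL_mul_cutMulY`, `cdSL_mul_cutMulY_leib`, `cutMulY_mul_cdsSL`,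
`cutMulY_mul_cdsSL_leib`; §4 `cutCommY_lapSL_eq_sum_shift`, `cutCommY_lapSL_eq`, ★★ `KhY_eq_grad_right`, `lapSL_mul_cutMulY`, `deltaPrimeAY_mul_cutMulY_grad_right`;
§5 `cutMulY_bdiffY_mul_bshiftSL`, `cutMulY_fdiffY_mul_fshiftSL`, `cutCommY_lapSL_eq_div_left`, ★★ `KhY_eq_div_left`; §6 `GsqY_mul_deltaPrimeAY_mul_cubeProjY`,
★★ `cutMulY_GsqY_deltaPrimeAY_cutMulY`, ★ `eq388T_GsqY`, `fixedPoint388T_GsqY`, `GpY_eq_fixedPoint388T`.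

(Edition 2: the two «(3.25)» locators now read p. 394, where (3.25) and `G′ = (Δ′_a)⁻¹` are printed (the page owner's read); locators only, no declaration changed.)
-/

noncomputable section

namespace Literature.MathematicalPhysics.QuantumFieldTheory.Balaban1983to89.Node00.OpsYLeibnizLetters

open B6KLevelCensusIndexV1 (KIdx)
open B9Eq39Adjoint (R R_add R_sub R_smul R_inv_R R_R_inv)
open B9Ineq349SiteComposite (cdSL cdsSL cdSL_apply cdsSL_apply)
open B9Thm37CubeCoverCommutators (cutMulY cutMulY_apply cutMulY_mul cutMulY_add cutCommY cutCommY_apply mul_cutMulY_eq KhY KhY_eq_add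
  cutCommY_lapSL_apply cdS_cutMulY_apply sum_cutMulY_mul_self deltaPrimeAY_mul_cutMulY)
open B9Thm37CutoffDivTerms (cutMulY_cdsS_eq)
open B9Thm37TransposedCommutator (eq388T_sum)
open OpsYLocalInverse (GsqY padDeltaY cubeProjY GsqY_mul_cubeProjY cubeProjY_mul_cutMulY cutMulY_mul_cubeProjY GsqY_mul_compr_deltaPrimeAY)

variable {𝔸 : Type} [NormedRing 𝔸] [NormedAlgebra ℂ 𝔸] [CompleteSpace 𝔸]
variable {d ℓ : ℕ} {hd : 1 ≤ d + 1} {hL : Odd (ℓ + 1) ∧ 1 < ℓ + 1} {b₀ b₁ : ℝ}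
variable (i : KIdx d ℓ hd hL b₀ b₁)

/-! ## §1 Bond differences and the lattice Laplacian of a real cut-off -/

/-- the FORWARD bond difference `(∂⁺_μh)(z) = h(z+e_μ) − h(z)` (print's `(∂h)(b)`, `b = ⟨z, z+e_μ⟩`, lattice units).
[cite: Balaban1985BackgroundPropagators, (3.88) p.409, (3.100) p.413] -/
def fdiffY (h : SiteY i → ℝ) (μ : Fin (d + 1)) : SiteY i → ℝ := fun z => h (shiftY i μ z) - h z

/-- the BACKWARD bond difference `(∂⁻̃_μh)(z) = h(z−e_μ) − h(z)` (along the reversed bond `⟨z, z−e_μ⟩`).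
[cite: Balaban1985BackgroundPropagators, (3.88) p.409, (3.8) p.392] -/
def bdiffY (h : SiteY i → ℝ) (μ : Fin (d + 1)) : SiteY i → ℝ := fun z => h ((shiftY i μ).symm z) - h z

/-- the LATTICE LAPLACIAN of the cut-off, `(Δh)(z) = Σ_μ (h(z+e_μ) + h(z−e_μ) − 2h(z))` (print's `(Δh_□)(x)` in (3.88)).
[cite: Balaban1985BackgroundPropagators, (3.88) p.409] -/
def lapDiffY (h : SiteY i → ℝ) : SiteY i → ℝ := fun z => ∑ μ : Fin (d + 1), (h (shiftY i μ z) + h ((shiftY i μ).symm z) - 2 * h z)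

/-- `∂⁺_μh`, evaluated. [cite: Balaban1985BackgroundPropagators, (3.100) p.413, bookkeeping] -/
@[simp] theorem fdiffY_apply (h : SiteY i → ℝ) (μ : Fin (d + 1)) (z : SiteY i) : fdiffY i h μ z = h (shiftY i μ z) - h z := rfl

/-- `∂⁻̃_μh`, evaluated. [cite: Balaban1985BackgroundPropagators, (3.8) p.392, bookkeeping] -/
@[simp] theorem bdiffY_apply (h : SiteY i → ℝ) (μ : Fin (d + 1)) (z : SiteY i) : bdiffY i h μ z = h ((shiftY i μ).symm z) - h z := rfl

/-- `Δh`, evaluated. [cite: Balaban1985BackgroundPropagators, (3.88) p.409, bookkeeping] -/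
theorem lapDiffY_apply (h : SiteY i → ℝ) (z : SiteY i) :
    lapDiffY i h z = ∑ μ : Fin (d + 1), (h (shiftY i μ z) + h ((shiftY i μ).symm z) - 2 * h z) := rfl

/-- `Δh = Σ_μ (∂⁺_μh + ∂⁻̃_μh)`. [cite: Balaban1985BackgroundPropagators, (3.88) p.409, bookkeeping] -/
theorem lapDiffY_eq_sum (h : SiteY i → ℝ) (z : SiteY i) : lapDiffY i h z = ∑ μ : Fin (d + 1), (fdiffY i h μ z + bdiffY i h μ z) :=
  Finset.sum_congr rfl fun μ _ => by rw [fdiffY_apply, bdiffY_apply]; ring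

/-- `(∂⁺_μh)(z−e_μ) = −(∂⁻̃_μh)(z)`. [cite: Balaban1985BackgroundPropagators, (3.88) p.409, bookkeeping] -/
theorem fdiffY_symm_apply (h : SiteY i → ℝ) (μ : Fin (d + 1)) (z : SiteY i) : fdiffY i h μ ((shiftY i μ).symm z) = -bdiffY i h μ z := by
  rw [fdiffY_apply, bdiffY_apply, Equiv.apply_symm_apply]; ring

/-- `(∂⁻̃_μh)(z+e_μ) = −(∂⁺_μh)(z)`. [cite: Balaban1985BackgroundPropagators, (3.88) p.409, bookkeeping] -/
theorem bdiffY_shift_apply (h : SiteY i → ℝ) (μ : Fin (d + 1)) (z : SiteY i) : bdiffY i h μ (shiftY i μ z) = -fdiffY i h μ z := by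
  rw [fdiffY_apply, bdiffY_apply, Equiv.symm_apply_apply]; ring

omit [CompleteSpace 𝔸] in
/-- `M_{Δh} = Σ_μ (M_{∂⁺_μh} + M_{∂⁻̃_μh})` as multiplication operators. [cite: Balaban1985BackgroundPropagators, (3.88) p.409, bookkeeping] -/
theorem cutMulY_lapDiffY (h : SiteY i → ℝ) :
    cutMulY (𝔸 := 𝔸) (lapDiffY i h) = ∑ μ : Fin (d + 1), (cutMulY (fdiffY i h μ) + cutMulY (bdiffY i h μ)) := by
  refine LinearMap.ext fun Λ => funext fun z => ?_
  rw [cutMulY_apply, LinearMap.sum_apply, Finset.sum_apply, lapDiffY_eq_sum, Complex.ofReal_sum, Finset.sum_smul]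
  refine Finset.sum_congr rfl fun μ _ => ?_
  rw [LinearMap.add_apply, Pi.add_apply, cutMulY_apply, cutMulY_apply, Complex.ofReal_add, add_smul]

/-! ## §2 The covariant shifts `S_μ = ∇_{U,μ} + 1`, `S*_μ = ∇*_{U,μ} + 1` and the transport dictionary -/

/-- the covariant FORWARD SHIFT `(S_μΛ)(z) = R(U_μ(z))Λ(z+e_μ)` (print's `R(U(x,x+ηe_μ))A(x+ηe_μ)` of (3.100)), `S_μ = ∇_{U,μ} + 1`.
[cite: Balaban1985BackgroundPropagators, (3.100) p.413, (3.3) p.390] -/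
def fshiftSL (U : CfgY 𝔸 i) (μ : Fin (d + 1)) : (SiteY i → 𝔸) →ₗ[ℂ] (SiteY i → 𝔸) := cdSL i U μ + 1

/-- the covariant BACKWARD SHIFT `(S*_μΛ)(z) = R(U_μ(z−e_μ))⁻¹Λ(z−e_μ)`, `S*_μ = ∇*_{U,μ} + 1` (the adjoint derivative along the reversed bond, plus one).
[cite: Balaban1985BackgroundPropagators, (3.8) p.392, (3.5) p.391] -/
def bshiftSL (U : CfgY 𝔸 i) (μ : Fin (d + 1)) : (SiteY i → 𝔸) →ₗ[ℂ] (SiteY i → 𝔸) := cdsSL i U μ + 1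

/-- `S_μ`, evaluated. [cite: Balaban1985BackgroundPropagators, (3.3) p.390, (3.100) p.413] -/
theorem fshiftSL_apply (U : CfgY 𝔸 i) (μ : Fin (d + 1)) (Λ : SiteY i → 𝔸) (z : SiteY i) :
    fshiftSL i U μ Λ z = R (UboxY i U μ z) (Λ (shiftY i μ z)) := by
  rw [fshiftSL, LinearMap.add_apply, Pi.add_apply, Module.End.one_apply, cdSL_apply]
  show R (UboxY i U μ z) (Λ (shiftY i μ z)) - Λ z + Λ z = _
  rw [sub_add_cancel]

/-- `S*_μ`, evaluated. [cite: Balaban1985BackgroundPropagators, (3.8) p.392, (3.5) p.391] -/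
theorem bshiftSL_apply (U : CfgY 𝔸 i) (μ : Fin (d + 1)) (Λ : SiteY i → 𝔸) (z : SiteY i) :
    bshiftSL i U μ Λ z = R (UboxY i U μ ((shiftY i μ).symm z))⁻¹ (Λ ((shiftY i μ).symm z)) := by
  rw [bshiftSL, LinearMap.add_apply, Pi.add_apply, Module.End.one_apply, cdsSL_apply]
  show R (UboxY i U μ ((shiftY i μ).symm z))⁻¹ (Λ ((shiftY i μ).symm z)) - Λ z + Λ z = _
  rw [sub_add_cancel]

/-- `∇_{U,μ} = S_μ − 1`. [cite: Balaban1985BackgroundPropagators, (3.3) p.390, bookkeeping] -/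
theorem cdSL_eq_fshiftSL_sub_one (U : CfgY 𝔸 i) (μ : Fin (d + 1)) : cdSL i U μ = fshiftSL i U μ - 1 := by
  rw [fshiftSL, add_sub_cancel_right]

/-- `∇*_{U,μ} = S*_μ − 1`. [cite: Balaban1985BackgroundPropagators, (3.8) p.392, bookkeeping] -/
theorem cdsSL_eq_bshiftSL_sub_one (U : CfgY 𝔸 i) (μ : Fin (d + 1)) : cdsSL i U μ = bshiftSL i U μ - 1 := by
  rw [bshiftSL, add_sub_cancel_right]

/-- ★ the shifts are mutually inverse: `S_μS*_μ = 1` (`R(U_μ z)R(U_μ z)⁻¹ = 1`). [cite: Balaban1985BackgroundPropagators, (3.5) p.391, (3.8) p.392] -/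
theorem fshiftSL_mul_bshiftSL (U : CfgY 𝔸 i) (μ : Fin (d + 1)) : fshiftSL i U μ * bshiftSL i U μ = 1 := by
  refine LinearMap.ext fun Λ => funext fun z => ?_
  rw [Module.End.mul_apply, Module.End.one_apply, fshiftSL_apply, bshiftSL_apply, Equiv.symm_apply_apply, R_R_inv]

/-- ★ `S*_μS_μ = 1`. [cite: Balaban1985BackgroundPropagators, (3.5) p.391, (3.8) p.392] -/
theorem bshiftSL_mul_fshiftSL (U : CfgY 𝔸 i) (μ : Fin (d + 1)) : bshiftSL i U μ * fshiftSL i U μ = 1 := by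
  refine LinearMap.ext fun Λ => funext fun z => ?_
  rw [Module.End.mul_apply, Module.End.one_apply, bshiftSL_apply, fshiftSL_apply, Equiv.apply_symm_apply, R_inv_R]

/-- ★ **`∇*_{U,μ} = −S*_μ∇_{U,μ}`** (the adjoint derivative is minus the back-transported forward derivative).
[cite: Balaban1985BackgroundPropagators, (3.8) p.392, (3.3) p.390, (3.5) p.391] -/
theorem cdsSL_eq_neg_bshiftSL_mul_cdSL (U : CfgY 𝔸 i) (μ : Fin (d + 1)) : cdsSL i U μ = -(bshiftSL i U μ * cdSL i U μ) := by
  rw [cdsSL_eq_bshiftSL_sub_one, cdSL_eq_fshiftSL_sub_one, mul_sub, bshiftSL_mul_fshiftSL, mul_one, neg_sub]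

/-- `∇*_{U,μ} = −∇_{U,μ}S*_μ`. [cite: Balaban1985BackgroundPropagators, (3.8) p.392, (3.3) p.390, (3.5) p.391] -/
theorem cdsSL_eq_neg_cdSL_mul_bshiftSL (U : CfgY 𝔸 i) (μ : Fin (d + 1)) : cdsSL i U μ = -(cdSL i U μ * bshiftSL i U μ) := by
  rw [cdsSL_eq_bshiftSL_sub_one, cdSL_eq_fshiftSL_sub_one, sub_mul, fshiftSL_mul_bshiftSL, one_mul, neg_sub]

/-- `∇_{U,μ} = −S_μ∇*_{U,μ}`. [cite: Balaban1985BackgroundPropagators, (3.3) p.390, (3.8) p.392, (3.5) p.391] -/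
theorem cdSL_eq_neg_fshiftSL_mul_cdsSL (U : CfgY 𝔸 i) (μ : Fin (d + 1)) : cdSL i U μ = -(fshiftSL i U μ * cdsSL i U μ) := by
  rw [cdsSL_eq_bshiftSL_sub_one, cdSL_eq_fshiftSL_sub_one, mul_sub, fshiftSL_mul_bshiftSL, mul_one, neg_sub]

/-- `∇_{U,μ} = −∇*_{U,μ}S_μ` (the operator form of `OpsYRead342Cross.cdS_eq_neg_cdsS_transport`).
[cite: Balaban1985BackgroundPropagators, (3.3) p.390, (3.8) p.392, (3.5) p.391] -/
theorem cdSL_eq_neg_cdsSL_mul_fshiftSL (U : CfgY 𝔸 i) (μ : Fin (d + 1)) : cdSL i U μ = -(cdsSL i U μ * fshiftSL i U μ) := by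
  rw [cdsSL_eq_bshiftSL_sub_one, cdSL_eq_fshiftSL_sub_one, sub_mul, bshiftSL_mul_fshiftSL, one_mul, neg_sub]

/-! ## §3 The Leibniz rules (3.100) as operator identities -/

/-- ★ **(3.100), FORWARD, AS OPERATORS**: `∇_{U,μ}∘M_h = M_h∘∇_{U,μ} + M_{∂⁺_μh}∘S_μ` («(D_μhA)(x) = h(x)(D_μA)(x) + (∂_μh)(x)R(U(x,x+ηe_μ))A(x+ηe_μ)»).
[cite: Balaban1985BackgroundPropagators, (3.100) p.413] -/
theorem cdSL_mul_cutMulY (U : CfgY 𝔸 i) (μ : Fin (d + 1)) (h : SiteY i → ℝ) :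
    cdSL i U μ * cutMulY h = cutMulY h * cdSL i U μ + cutMulY (fdiffY i h μ) * fshiftSL i U μ := by
  refine LinearMap.ext fun Λ => funext fun z => ?_
  have e1 : ∀ (Ψ : SiteY i → 𝔸) (w : SiteY i), cdS i U μ Ψ w = R (UboxY i U μ w) (Ψ (shiftY i μ w)) - Ψ w := fun _ _ => rfl
  rw [Module.End.mul_apply, LinearMap.add_apply, Pi.add_apply, Module.End.mul_apply, Module.End.mul_apply, cdSL_apply, cdSL_apply,
    cdS_cutMulY_apply, cutMulY_apply, e1, cutMulY_apply, fshiftSL_apply, fdiffY_apply, Complex.ofReal_sub, sub_smul, smul_sub]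
  abel

/-- the same rule in the `leibD` shape `∇_μ∘M_h = M_h∘∇_μ + (P^D_μ∘∇_μ + C^D_μ)` with `P^D_μ = C^D_μ = M_{∂⁺_μh}` (`S_μ = ∇_μ + 1`).
[cite: Balaban1985BackgroundPropagators, (3.100) p.413] -/
theorem cdSL_mul_cutMulY_leib (U : CfgY 𝔸 i) (μ : Fin (d + 1)) (h : SiteY i → ℝ) :
    cdSL i U μ * cutMulY h = cutMulY h * cdSL i U μ + (cutMulY (fdiffY i h μ) * cdSL i U μ + cutMulY (fdiffY i h μ)) := by
  rw [cdSL_mul_cutMulY, fshiftSL, mul_add, mul_one]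

/-- ★ **(3.100), BACKWARD, AS OPERATORS**: `M_h∘∇*_{U,μ} = ∇*_{U,μ}∘M_h − M_{∂⁻̃_μh}∘S*_μ` (the operator form of `B9Thm37CutoffDivTerms.cutMulY_cdsS_eq`).
[cite: Balaban1985BackgroundPropagators, (3.100) p.413, (3.8) p.392] -/
theorem cutMulY_mul_cdsSL (U : CfgY 𝔸 i) (μ : Fin (d + 1)) (h : SiteY i → ℝ) :
    cutMulY h * cdsSL i U μ = cdsSL i U μ * cutMulY h - cutMulY (bdiffY i h μ) * bshiftSL i U μ := by
  refine LinearMap.ext fun Λ => funext fun z => ?_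
  rw [Module.End.mul_apply, LinearMap.sub_apply, Pi.sub_apply, Module.End.mul_apply, Module.End.mul_apply, cdsSL_apply, cdsSL_apply,
    cutMulY_cdsS_eq, cutMulY_apply, bshiftSL_apply, bdiffY_apply, Complex.ofReal_sub, Complex.ofReal_sub, sub_smul, sub_smul]
  abel

/-- the `leibT` letter `C^{Lt}_μ(U,h) := −M_{∂⁻̃_μh}∘S*_μ` («(h(w) − h(w−e_μ))·R(U_μ(w−e_μ))⁻¹Λ(w−e_μ)»).
[cite: Balaban1985BackgroundPropagators, (3.100) p.413, (3.8) p.392] -/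
def cltY (U : CfgY 𝔸 i) (h : SiteY i → ℝ) (μ : Fin (d + 1)) : Module.End ℂ (SiteY i → 𝔸) := -(cutMulY (bdiffY i h μ) * bshiftSL i U μ)

/-- the backward rule in the `leibT` shape `M_h∘∇*_μ = ∇*_μ∘M_h + C^{Lt}_μ`. [cite: Balaban1985BackgroundPropagators, (3.100) p.413, (3.8) p.392] -/
theorem cutMulY_mul_cdsSL_leib (U : CfgY 𝔸 i) (μ : Fin (d + 1)) (h : SiteY i → ℝ) :
    cutMulY h * cdsSL i U μ = cdsSL i U μ * cutMulY h + cltY i U h μ := by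
  rw [cutMulY_mul_cdsSL, cltY, sub_eq_add_neg]

/-! ## §4 The gradient-RIGHT split: `K_Δ(h) = Σ_μ P_μ∇_{U,μ} + M_{Δh}`, `K(h) = Σ_μ P_μ∇_{U,μ} + C` -/

/-- the first display line of (3.88) AS OPERATORS: `K_Δ(h) = Σ_μ (M_{∂⁺_μh}∘S_μ + M_{∂⁻̃_μh}∘S*_μ)` (M5.7's `cutCommY_lapSL_apply`, bundled).
[cite: Balaban1985BackgroundPropagators, (3.88) p.409 (first line)] -/
theorem cutCommY_lapSL_eq_sum_shift (U : CfgY 𝔸 i) (h : SiteY i → ℝ) :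
    cutCommY h (lapSL i U) = ∑ μ : Fin (d + 1), (cutMulY (fdiffY i h μ) * fshiftSL i U μ + cutMulY (bdiffY i h μ) * bshiftSL i U μ) := by
  refine LinearMap.ext fun Λ => funext fun z => ?_
  rw [cutCommY_lapSL_apply, LinearMap.sum_apply, Finset.sum_apply]
  refine Finset.sum_congr rfl fun μ _ => ?_
  rw [LinearMap.add_apply, Pi.add_apply, Module.End.mul_apply, Module.End.mul_apply, cutMulY_apply, cutMulY_apply, fshiftSL_apply,
    bshiftSL_apply, fdiffY_apply, bdiffY_apply]

/-- ★ print's `P`-LETTER of (3.89), direction `μ`, in the gradient-RIGHT form: `P_μ(U,h) := M_{∂⁺_μh} − M_{∂⁻̃_μh}∘S*_μ`, so that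
`(∂⁺_μh)·S_μ + (∂⁻̃_μh)·S*_μ = P_μ∘∇_{U,μ} + (∂⁺_μh + ∂⁻̃_μh)·` (first order in `∂h`, composed with the covariant derivative on the RIGHT).
[cite: Balaban1985BackgroundPropagators, (3.88)–(3.89) p.409; Balaban1984PropagatorsII, (2.39)–(2.40) pp.229–230] -/
def pKY (U : CfgY 𝔸 i) (h : SiteY i → ℝ) (μ : Fin (d + 1)) : Module.End ℂ (SiteY i → 𝔸) :=
  cutMulY (fdiffY i h μ) - cutMulY (bdiffY i h μ) * bshiftSL i U μ

/-- ★ **`K_Δ(h) = Σ_μ P_μ∘∇_{U,μ} + M_{Δh}`** — print's «Σ_b(∂h)(b)(D_Uλ)(b) + (Δh)λ» with every term composed with `∇_U` on the right.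
[cite: Balaban1985BackgroundPropagators, (3.88)–(3.89) p.409] -/
theorem cutCommY_lapSL_eq (U : CfgY 𝔸 i) (h : SiteY i → ℝ) :
    cutCommY h (lapSL i U) = (∑ μ : Fin (d + 1), pKY i U h μ * cdSL i U μ) + cutMulY (lapDiffY i h) := by
  rw [cutCommY_lapSL_eq_sum_shift, cutMulY_lapDiffY, ← Finset.sum_add_distrib]
  refine Finset.sum_congr rfl fun μ _ => ?_
  rw [pKY, sub_mul, mul_assoc, ← neg_neg (bshiftSL i U μ * cdSL i U μ), ← cdsSL_eq_neg_bshiftSL_mul_cdSL, fshiftSL, bshiftSL]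
  simp only [mul_add, mul_one, mul_neg, sub_neg_eq_add]
  abel

/-- the AVERAGING LINE of `K(h)` (M5.7's second display line of (3.88); [4] (2.39)) as a named letter: the kernel operator with kernel
`avgCoeffY(z,w)(h z − h w)` and the averaging transport of def-Y's `Δ′_a`. [cite: Balaban1985BackgroundPropagators, (3.88) p.409; Balaban1984PropagatorsII, (2.39) p.229] -/
def kavgY (par : SiteParY 𝔸 i) (h : SiteY i → ℝ) (U : CfgY 𝔸 i) : Module.End ℂ (SiteY i → 𝔸) :=
  kernelTrOpY (fun z w => avgCoeffY i z w * (h z - h w)) (avgTrY i par U)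

/-- ★ print's `C`-LETTER of (3.89) in the gradient-RIGHT form: `C(U,h) := M_{Δh} + (the averaging line)` (second order in `h`: `Δh` and
`h(z) − h(w)` over a block). [cite: Balaban1985BackgroundPropagators, (3.88)–(3.89) p.409; Balaban1984PropagatorsII, (2.39)–(2.40) pp.229–230] -/
def cKY (par : SiteParY 𝔸 i) (h : SiteY i → ℝ) (U : CfgY 𝔸 i) : Module.End ℂ (SiteY i → 𝔸) :=
  cutMulY (lapDiffY i h) + kavgY i par h U

/-- ★★ **`K(h) = P∇_U + C` AT def-Y's LETTERS, gradient-RIGHT**: `K(h)(U) = Σ_μ P_μ(U,h)∘∇_{U,μ} + C(U,h)` — the shape `(P∘D + Cop)` of the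
rows-18–19 identity `eq388`, with one `P`-letter per lattice direction. [cite: Balaban1985BackgroundPropagators, (3.88)–(3.89) p.409] -/
theorem KhY_eq_grad_right (par : SiteParY 𝔸 i) (h : SiteY i → ℝ) (U : CfgY 𝔸 i) :
    KhY i par h U = (∑ μ : Fin (d + 1), pKY i U h μ * cdSL i U μ) + cKY i par h U := by
  rw [KhY_eq_add, cutCommY_lapSL_eq, cKY, kavgY, add_assoc]

/-- ★ **LEIBNIZ FOR THE COVARIANT LAPLACIAN** (the `leibL` shape, `PL_μ = −P_μ`, `CL = −M_{Δh}`): `Δ_U∘M_h = M_h∘Δ_U − (Σ_μ P_μ∘∇_{U,μ} + M_{Δh})`.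
[cite: Balaban1985BackgroundPropagators, (3.88) p.409 (first line), (3.100) p.413] -/
theorem lapSL_mul_cutMulY (U : CfgY 𝔸 i) (h : SiteY i → ℝ) :
    lapSL i U * cutMulY h = cutMulY h * lapSL i U - ((∑ μ : Fin (d + 1), pKY i U h μ * cdSL i U μ) + cutMulY (lapDiffY i h)) := by
  rw [mul_cutMulY_eq, cutCommY_lapSL_eq]

/-- (3.88) with the split inserted: `Δ′_a(U)∘M_h = M_h∘Δ′_a(U) − (Σ_μ P_μ∘∇_{U,μ} + C)`. [cite: Balaban1985BackgroundPropagators, (3.88)–(3.89) p.409] -/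
theorem deltaPrimeAY_mul_cutMulY_grad_right (par : SiteParY 𝔸 i) (h : SiteY i → ℝ) (U : CfgY 𝔸 i) :
    deltaPrimeAY i par U * cutMulY h
      = cutMulY h * deltaPrimeAY i par U - ((∑ μ : Fin (d + 1), pKY i U h μ * cdSL i U μ) + cKY i par h U) := by
  rw [deltaPrimeAY_mul_cutMulY, KhY_eq_grad_right]

/-! ## §5 The divergence-LEFT split: `K(h) = −(Σ_μ ∇*_{U,μ}∘Pt_μ + Ct)` -/

/-- `M_{∂⁻̃_μh}∘S*_μ = −∇*_{U,μ}∘M_{∂⁺_μh} − M_{∂⁺_μh}` (`(∂⁺_μh)(z−e_μ) = −(∂⁻̃_μh)(z)`).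
[cite: Balaban1985BackgroundPropagators, (3.88) p.409, (3.8) p.392] -/
theorem cutMulY_bdiffY_mul_bshiftSL (U : CfgY 𝔸 i) (h : SiteY i → ℝ) (μ : Fin (d + 1)) :
    cutMulY (bdiffY i h μ) * bshiftSL i U μ = -(cdsSL i U μ * cutMulY (fdiffY i h μ)) - cutMulY (fdiffY i h μ) := by
  refine LinearMap.ext fun Λ => funext fun z => ?_
  have e2 : ∀ (Ψ : SiteY i → 𝔸) (w : SiteY i),
      cdsS i U μ Ψ w = R (UboxY i U μ ((shiftY i μ).symm w))⁻¹ (Ψ ((shiftY i μ).symm w)) - Ψ w := fun _ _ => rfl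
  simp only [Module.End.mul_apply, LinearMap.sub_apply, LinearMap.neg_apply, Pi.sub_apply, Pi.neg_apply, cdsSL_apply, e2, cutMulY_apply,
    bshiftSL_apply, R_smul]
  simp only [bdiffY_apply, fdiffY_apply, Equiv.apply_symm_apply, Complex.ofReal_sub, sub_smul]
  abel

/-- `M_{∂⁺_μh}∘S_μ = −∇*_{U,μ}∘(M_{∂⁺_μh}∘S_μ) − M_{∂⁻̃_μh}` (`S*_μS_μ = 1` on the diagonal term).
[cite: Balaban1985BackgroundPropagators, (3.88) p.409, (3.8) p.392, (3.5) p.391] -/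
theorem cutMulY_fdiffY_mul_fshiftSL (U : CfgY 𝔸 i) (h : SiteY i → ℝ) (μ : Fin (d + 1)) :
    cutMulY (fdiffY i h μ) * fshiftSL i U μ = -(cdsSL i U μ * (cutMulY (fdiffY i h μ) * fshiftSL i U μ)) - cutMulY (bdiffY i h μ) := by
  refine LinearMap.ext fun Λ => funext fun z => ?_
  have e2 : ∀ (Ψ : SiteY i → 𝔸) (w : SiteY i),
      cdsS i U μ Ψ w = R (UboxY i U μ ((shiftY i μ).symm w))⁻¹ (Ψ ((shiftY i μ).symm w)) - Ψ w := fun _ _ => rfl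
  simp only [Module.End.mul_apply, LinearMap.sub_apply, LinearMap.neg_apply, Pi.sub_apply, Pi.neg_apply, cdsSL_apply, e2, cutMulY_apply,
    fshiftSL_apply, Equiv.apply_symm_apply, R_smul, R_inv_R]
  simp only [bdiffY_apply, fdiffY_apply, Equiv.apply_symm_apply, Complex.ofReal_sub, sub_smul]
  abel

/-- ★ print's TRANSPOSED `P`-letter, direction `μ`: `Pt_μ(U,h) := M_{∂⁺_μh}∘(S_μ + 1)` (first order in `∂h`, to be composed with `∇*_{U,μ}` on the LEFT).
[cite: Balaban1985BackgroundPropagators, (3.88)–(3.89) p.409; Balaban1984PropagatorsII, (2.39)–(2.40) pp.229–230] -/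
def ptKY (U : CfgY 𝔸 i) (h : SiteY i → ℝ) (μ : Fin (d + 1)) : Module.End ℂ (SiteY i → 𝔸) :=
  cutMulY (fdiffY i h μ) * (fshiftSL i U μ + 1)

/-- ★ the TRANSPOSED `C`-letter: `Ct(U,h) := M_{Δh} − (the averaging line)`. [cite: Balaban1985BackgroundPropagators, (3.88)–(3.89) p.409] -/
def ctKY (par : SiteParY 𝔸 i) (h : SiteY i → ℝ) (U : CfgY 𝔸 i) : Module.End ℂ (SiteY i → 𝔸) :=
  cutMulY (lapDiffY i h) - kavgY i par h U

/-- ★ **`K_Δ(h) = −Σ_μ ∇*_{U,μ}∘Pt_μ − M_{Δh}`** — the first line of (3.88) regrouped with the covariant DIVERGENCE on the LEFT (summation by parts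
on the lattice; cf. M5.5's pointwise `commTerm_eq`, which regroups with `∇_μ` on the left instead).
[cite: Balaban1985BackgroundPropagators, (3.88) p.409, (3.8) p.392] -/
theorem cutCommY_lapSL_eq_div_left (U : CfgY 𝔸 i) (h : SiteY i → ℝ) :
    cutCommY h (lapSL i U) = -(∑ μ : Fin (d + 1), cdsSL i U μ * ptKY i U h μ) - cutMulY (lapDiffY i h) := by
  rw [cutCommY_lapSL_eq_sum_shift, cutMulY_lapDiffY, ← Finset.sum_neg_distrib, ← Finset.sum_sub_distrib]
  refine Finset.sum_congr rfl fun μ _ => ?_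
  rw [cutMulY_fdiffY_mul_fshiftSL, cutMulY_bdiffY_mul_bshiftSL, ptKY, mul_add, mul_one, mul_add]
  abel

/-- ★★ **`K(h)` AT def-Y's LETTERS, divergence-LEFT**: `K(h)(U) = −(Σ_μ ∇*_{U,μ}∘Pt_μ(U,h) + Ct(U,h))` — the shape `Dstar∘Pt + Ct` (`= −K(h)`)
of the rows-18–19 identity `eq388T`, with one `Pt`-letter per lattice direction. [cite: Balaban1985BackgroundPropagators, (3.88)–(3.89) p.409] -/
theorem KhY_eq_div_left (par : SiteParY 𝔸 i) (h : SiteY i → ℝ) (U : CfgY 𝔸 i) :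
    KhY i par h U = -((∑ μ : Fin (d + 1), cdsSL i U μ * ptKY i U h μ) + ctKY i par h U) := by
  rw [KhY_eq_add, cutCommY_lapSL_eq_div_left, ctKY, kavgY]
  abel

/-! ## §6 The RIGHT local-inverse property and the transposed (3.88) at the genuine cube inverses `G′_□(U)` -/

/-- `G′_□(U) Δ′_a(U) P_D = P_D` (from `G′_□ (P_DΔ′_aP_D) = P_D` and `G′_□P_D = G′_□`). [cite: Balaban1985BackgroundPropagators, pp.408–409 (G′_□(U) for the sequence {Ω_n(□)}), (3.87) p.409, (3.25) p.394] -/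
theorem GsqY_mul_deltaPrimeAY_mul_cubeProjY (par : SiteParY 𝔸 i) {D : Finset (SiteY i)} {U : CfgY 𝔸 i} (hU : IsUnit (padDeltaY i par D U)) :
    GsqY i par D U * deltaPrimeAY i par U * cubeProjY i D = cubeProjY i D := by
  have e : GsqY i par D U * deltaPrimeAY i par U * cubeProjY i D
      = GsqY i par D U * (cubeProjY i D * deltaPrimeAY i par U * cubeProjY i D) := by
    conv_lhs => rw [← GsqY_mul_cubeProjY i par D U]
    simp only [mul_assoc]
  rw [e, GsqY_mul_compr_deltaPrimeAY i par hU]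

/-- ★★ **THE RIGHT LOCAL-INVERSE PROPERTY DISCHARGED**: for every cut-off `h` supported in □̃, `h G′_□(U) Δ′_a(U) h = h²` — the hypothesis `hlocT` of
M5.5's `B9Thm37TransposedCommutator.eq388T_hT`, from invertibility of the compressed operator alone (twin of FILE A-0's `cutMulY_deltaPrimeAY_GsqY_cutMulY`).
[cite: Balaban1985BackgroundPropagators, (3.87)–(3.88) p.409, pp.408–409 (supp h_□ ⊂ □̃ ⊂ Ω₀(□))] -/
theorem cutMulY_GsqY_deltaPrimeAY_cutMulY (par : SiteParY 𝔸 i) {D : Finset (SiteY i)} {U : CfgY 𝔸 i} (hU : IsUnit (padDeltaY i par D U))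
    (h : SiteY i → ℝ) (hD : ∀ z, h z ≠ 0 → z ∈ D) :
    cutMulY h * GsqY i par D U * deltaPrimeAY i par U * cutMulY h = cutMulY h * cutMulY h := by
  calc cutMulY h * GsqY i par D U * deltaPrimeAY i par U * cutMulY h
      = cutMulY h * GsqY i par D U * deltaPrimeAY i par U * (cubeProjY i D * cutMulY h) := by rw [cubeProjY_mul_cutMulY i h hD]
    _ = cutMulY h * (GsqY i par D U * deltaPrimeAY i par U * cubeProjY i D) * cutMulY h := by simp only [mul_assoc]
    _ = cutMulY h * cutMulY h := by rw [GsqY_mul_deltaPrimeAY_mul_cubeProjY i par hU, cutMulY_mul_cubeProjY i h hD]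

/-- ★ **THE TRANSPOSED (3.88) AT THE GENUINE LOCAL INVERSES**: over any real family with `Σ_c h_c² = 1`, each `h_c` supported in its cube `D c` and
every compressed `Δ′_a(U)` invertible, `(Σ_c h_c G′_{□_c}(U) h_c)·Δ′_a(U) = 1 + Σ_c h_c G′_{□_c}(U) K(h_c)(U)` (M5.5's `eq388T_sum`, hypothesis discharged).
[cite: Balaban1985BackgroundPropagators, (3.87)–(3.88) p.409] -/
theorem eq388T_GsqY (par : SiteParY 𝔸 i) (U : CfgY 𝔸 i) {ι : Type} [Fintype ι] (hf : ι → SiteY i → ℝ) (hsq : ∀ z, ∑ c, hf c z ^ 2 = 1)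
    (D : ι → Finset (SiteY i)) (hD : ∀ c z, hf c z ≠ 0 → z ∈ D c) (hU : ∀ c, IsUnit (padDeltaY i par (D c) U)) :
    (∑ c, cutMulY (hf c) * GsqY i par (D c) U * cutMulY (hf c)) * deltaPrimeAY i par U
      = 1 + ∑ c, cutMulY (hf c) * GsqY i par (D c) U * KhY i par (hf c) U :=
  eq388T_sum (deltaPrimeAY i par U) (fun c => cutMulY (hf c)) (fun c => GsqY i par (D c) U) (fun c => KhY i par (hf c) U)
    (fun c => deltaPrimeAY_mul_cutMulY i par (hf c) U) (fun c => cutMulY_GsqY_deltaPrimeAY_cutMulY i par (hU c) (hf c) (hD c))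
    (sum_cutMulY_mul_self hf hsq)

/-- ★ **(3.90)ᵀ as a fixed point AT THE GENUINE LOCAL INVERSES**: any right inverse `G′` of `Δ′_a(U)` equals `G′₀ − Vᵀ G′` with
`Vᵀ = Σ_c h_c G′_{□_c}(U) K(h_c)(U)`. [cite: Balaban1985BackgroundPropagators, (3.90) p.409, (3.87)–(3.88) p.409] -/
theorem fixedPoint388T_GsqY (par : SiteParY 𝔸 i) (U : CfgY 𝔸 i) {ι : Type} [Fintype ι] (hf : ι → SiteY i → ℝ) (hsq : ∀ z, ∑ c, hf c z ^ 2 = 1)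
    (D : ι → Finset (SiteY i)) (hD : ∀ c z, hf c z ≠ 0 → z ∈ D c) (hU : ∀ c, IsUnit (padDeltaY i par (D c) U))
    {G' : Module.End ℂ (SiteY i → 𝔸)} (hinv : deltaPrimeAY i par U * G' = 1) :
    G' = (∑ c, cutMulY (hf c) * GsqY i par (D c) U * cutMulY (hf c))
        - (∑ c, cutMulY (hf c) * GsqY i par (D c) U * KhY i par (hf c) U) * G' := by
  have e := congrArg (· * G') (eq388T_GsqY i par U hf hsq D hD hU)
  rw [mul_assoc, hinv, mul_one, add_mul, one_mul] at e
  rw [e, add_sub_cancel_right]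

/-- in particular with def-Y's genuine `G′(U) = GpY` in the regime where `Δ′_a(U)` is invertible. [cite: Balaban1985BackgroundPropagators, (3.90) p.409, (3.25) p.394] -/
theorem GpY_eq_fixedPoint388T (par : SiteParY 𝔸 i) (U : CfgY 𝔸 i) {ι : Type} [Fintype ι] (hf : ι → SiteY i → ℝ) (hsq : ∀ z, ∑ c, hf c z ^ 2 = 1)
    (D : ι → Finset (SiteY i)) (hD : ∀ c z, hf c z ≠ 0 → z ∈ D c) (hU : ∀ c, IsUnit (padDeltaY i par (D c) U))
    (hUg : IsUnit (deltaPrimeAY i par U)) :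
    GpY i par U = (∑ c, cutMulY (hf c) * GsqY i par (D c) U * cutMulY (hf c))
        - (∑ c, cutMulY (hf c) * GsqY i par (D c) U * KhY i par (hf c) U) * GpY i par U :=
  fixedPoint388T_GsqY i par U hf hsq D hD hU (deltaPrimeAY_mul_GpY i par U hUg)

end Literature.MathematicalPhysics.QuantumFieldTheory.Balaban1983to89.Node00.OpsYLeibnizLetters
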